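import Literature.NumberTheory.EllipticCurves.DeShalit1987.LMeasureCosetValues
import Literature.NumberTheory.EllipticCurves.DeShalit1987.RayClassTower
import Literature.NumberTheory.ComplexMultiplication.EllipticUnits.RingOfIntegersPeriodLattice
import Literature.NumberTheory.ComplexMultiplication.EllipticUnits.RubinEulerSystem
import Literature.NumberTheory.GaloisRepresentations.IntegralGaloisActionProofs
import Literature.NumberTheory.GaloisRepresentations.ArtinReciprocityCharacterFiniteProofs
import Literature.NumberTheory.GaloisRepresentations.GlobalArtinMapOfCharactersProofs
import Literature.NumberTheory.GaloisRepresentations.CyclotomicFrobenius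
import HarnessLib

/-!
# de Shalit 1987, II.5.2 (4) on the `𝔭`-ramified cosets — PROOFS companion of `LMeasureCosetValues.lean`:
# every binder of `IsCosetValues` is instantiable on the witness of II Thm. 4.14, and the consumer form

Proofs companion (port P56 of cell `bsd-print-cf2`, crux `SplitBadTwoLowerHalfOfFacts`, STUB-PLAN v7.6
rows 123–124 «R223-H»; one copy per helper of stub-ideation k1-g40 §A–§D and k2-g42 §1–§7). Everything
here is PROVED from the tree's class-field-theory layer; the only named fact consumed (as a hypothesis,
by name) is II.2.4 (i) `DeShalit1987.prop24_i_mem_rayClassField` for the unit `e_n(𝔞) ∈ K(𝔤)`.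
Nothing here is about BSD; no new named fact.

* §1 H2 `rayKer_le_ker` (`rayKer K p S` fixes `K(𝔤)` when `supp 𝔤 ⊆ S ∪ {v, v̄}`, II.4.12 Remark (i)), `supp_mul_pow`;
  §2 H2′ `isTowerContinuous_galCharInv` (the integrand `χ̂⁻¹` is tower-continuous on the tower of Thm. 4.14 —
  the hypothesis of `IsCosetValues` costs nothing), (d1) `exists_integral_galCharInv_eq_sum` (the integral IS a
  finite Riemann sum, I.3.1), (d2) `isCoprime_span_kappaRep` (no junk Artin symbol); §3 H1
  `exists_forall_absRestrictNormalHom_eq_galFrob` (ONE absolute Frobenius restricts to `galFrob K L v` on every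
  finite abelian `L` unramified at `v`), `exists_frobPowLift`, `exists_frobLift`; §4 H3 `exists_unit`
  (`e_n(𝔞) ∈ K(𝔤)` from II.2.4 (i)), `exists_thetaData`; §5 `exists_orientation`, `exists_kappaReps`;
  §6 THE CONSUMER FORM `exists_cosetValueIdentity`; §7 `smoothingFactor_ne_zero`, `integral_eq_of_cosetValueIdentity`.

References: [deShalit1987] II.5.2, II.4.11 (30), II.4.12 Remark (i), II.4.16 (49), II.4.4, II.2.4 (i), I.3.1;
[NeukirchANT1999] I §9 (9.4)–(9.5), VI §6 (6.6), VI §7 (7.1); [SerreAbelianLadic1968] I §2.1. The `p = 2` Gauss-sum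
DIGIT (norm `2^{−n/2}` at conductors 4, 8) is `Literature/NumberTheory/LFunctions/GaussSumTwoPowerNorm.lean`.
-/

noncomputable section

open scoped Classical
open NumberField IsDedekindDomain Field Complex
open Literature.NumberTheory.GaloisRepresentations
open Literature.NumberTheory.ComplexMultiplication.EllipticUnits
open Literature.NumberTheory.NumberFields (rayClassField isUnramifiedIn_rayClassField)
open Literature.NumberTheory.LFunctions.AbelianDensity (artinSymbol artinSymbol_finsuppProd)
open Literature.NumberTheory.LocalFields (PadicComplex.iwasawaLog)

namespace Literature.NumberTheory.EllipticCurves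

namespace DeShalit1987

variable {p : ℕ} [Fact p.Prime] {K : Type} [Field K] [NumberField K]

/-! ## §1 H2: `rayKer K p S ≤ ker(Γ_K → Gal(K(𝔤)/K))` for `supp 𝔤 ⊆ S ∪ {v, v̄}` -/

omit [Fact p.Prime] in
/-- **H2.** If every prime dividing `𝔤 ≠ 0` lies in `S ∪ {v, v̄}` with `v, v̄ ∣ p`, then `rayKer K p S` fixes
`K(𝔤)` («`χ` of conductor dividing `𝔣𝔭ⁿ` is a character of `𝒢`»; `K(𝔤)` is abelian, unramified off `𝔤`).
[cite: deShalit1987, II.4.12 Remark (i) (p. 67)] [cite: NeukirchANT1999, Ch. VI §6 Cor. (6.6)] -/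
theorem rayKer_le_ker (S : Finset (HeightOneSpectrum (𝓞 K))) (v vbar : HeightOneSpectrum (𝓞 K))
    (hv : ((p : ℕ) : 𝓞 K) ∈ v.asIdeal) (hvbar : ((p : ℕ) : 𝓞 K) ∈ vbar.asIdeal)
    (𝔤 : Ideal (𝓞 K)) (h𝔤 : 𝔤 ≠ ⊥)
    (hsupp : ∀ w : HeightOneSpectrum (𝓞 K), w.asIdeal ∣ 𝔤 → w ∈ S ∨ w = v ∨ w = vbar) :
    rayKer K p S ≤ (absRestrictNormalHom (rayClassField K 𝔤)).ker :=
  rayKer_le_ker_absRestrictNormalHom_rayClassField p S h𝔤 fun w hwS hwp hle ↦ by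
    rcases hsupp w (Ideal.dvd_iff_le.mpr hle) with h | rfl | rfl
    · exact hwS h
    · exact hwp hv
    · exact hwp hvbar

omit [Fact p.Prime] in
/-- The support clause of `IsCosetValues` (`w ∣ 𝔣 ↔ w ∈ S ∨ w = v̄`) gives the support hypothesis of H2 for
`𝔤 = 𝔣vⁿ`. [cite: deShalit1987, II.5.2 (p. 79)] -/
theorem supp_mul_pow {S : Finset (HeightOneSpectrum (𝓞 K))} {v vbar : HeightOneSpectrum (𝓞 K)}
    {𝔣 : Ideal (𝓞 K)} (hsupp : ∀ w : HeightOneSpectrum (𝓞 K), w.asIdeal ∣ 𝔣 ↔ (w ∈ S ∨ w = vbar))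
    (n : ℕ) (w : HeightOneSpectrum (𝓞 K)) (hw : w.asIdeal ∣ 𝔣 * v.asIdeal ^ n) :
    w ∈ S ∨ w = v ∨ w = vbar := by
  rcases (Ideal.IsPrime.mul_le w.isPrime).mp (Ideal.dvd_iff_le.mp hw) with h | h
  · rcases (hsupp w).mp (Ideal.dvd_iff_le.mpr h) with h' | h'
    · exact Or.inl h'
    · exact Or.inr (Or.inr h')
  · have hle : v.asIdeal ≤ w.asIdeal := w.isPrime.le_of_pow_le h
    have hmax : v.asIdeal.IsMaximal := v.isPrime.isMaximal v.ne_bot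
    exact Or.inr (Or.inl (HeightOneSpectrum.ext (hmax.eq_of_le w.isPrime.ne_top hle)).symm)

/-! ## §2 H2′: tower-continuity of `χ̂⁻¹` on the tower of Thm. 4.14; (d1) Riemann sum; (d2) no junk symbol -/

/-- **Tower-continuity of `χ̂⁻¹` along the tower of Thm. 4.14** (`U_n` open, `⋂ U_n ⊆ rayKer K p S`,
`supp 𝔤 ⊆ S ∪ {v, v̄}`): `galCharInv ι 𝔤 χ` is CONSTANT on the cosets of the open `ker(Γ_K → Gal(K(𝔤)/K)) ⊇ rayKer`
(H2) and the tower is cofinal above `rayKer` — so this hypothesis of `IsCosetValues` costs the consumer nothing.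
[cite: deShalit1987, II.4.16 (49) (p. 76), II.5.2 (p. 79)] -/
theorem isTowerContinuous_galCharInv (ι : PadicAlgCl p ≃+* ℂ) {S : Finset (HeightOneSpectrum (𝓞 K))}
    {v vbar : HeightOneSpectrum (𝓞 K)} (hv : ((p : ℕ) : 𝓞 K) ∈ v.asIdeal)
    (hvbar : ((p : ℕ) : 𝓞 K) ∈ vbar.asIdeal) {𝔤 : Ideal (𝓞 K)} (h𝔤 : 𝔤 ≠ ⊥)
    (hsupp : ∀ w : HeightOneSpectrum (𝓞 K), w.asIdeal ∣ 𝔤 → w ∈ S ∨ w = v ∨ w = vbar)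
    (χ : RayGal K 𝔤 →* ℂˣ) {𝒰 : SubgroupTower (absoluteGaloisGroup K)}
    (hU : ∀ n, IsOpen (𝒰.U n : Set (absoluteGaloisGroup K)))
    (hN : ⋂ n, (𝒰.U n : Set (absoluteGaloisGroup K)) ⊆ rayKer K p S) :
    𝒰.IsTowerContinuous (galCharInv ι 𝔤 χ) := by
  refine SubgroupTower.IsTowerContinuous.of_cofinal hU hN fun ε hε ↦
    ⟨((absRestrictNormalHom (rayClassField K 𝔤)).ker : Set (absoluteGaloisGroup K)),
      isOpen_ker_absRestrictNormalHom _, fun ν hν ↦ rayKer_le_ker S v vbar hv hvbar 𝔤 h𝔤 hsupp hν,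
      fun σ τ hστ ↦ ?_⟩
  have h : absRestrictNormalHom (rayClassField K 𝔤) σ = absRestrictNormalHom (rayClassField K 𝔤) τ := by
    have h1 : (absRestrictNormalHom (rayClassField K 𝔤)) (σ⁻¹ * τ) = 1 := hστ
    rwa [map_mul, map_inv, inv_mul_eq_one] at h1
  simp only [galCharInv, h, dist_self, hε]

/-- **(d1) The integral of `χ̂⁻¹` along the tower of Thm. 4.14 IS a finite Riemann sum**: for a level `N` with
`U_N ⊆ ker(Γ_K → Gal(K(𝔤)/K))` (H2 + cofinality), `∫ χ̂⁻¹ dμ = Σ_{a ∈ Γ_K/U_N} μ_N(a)·χ̂⁻¹(repr a)` (I.3.1 «if `G`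
is finite `Λ(G, M) ≃ M[G]`»). [cite: deShalit1987, I.3.1 (p. 16), II.4.16 (49) (p. 76)] -/
theorem exists_integral_galCharInv_eq_sum (ι : PadicAlgCl p ≃+* ℂ)
    {S : Finset (HeightOneSpectrum (𝓞 K))} {v vbar : HeightOneSpectrum (𝓞 K)}
    (hv : ((p : ℕ) : 𝓞 K) ∈ v.asIdeal) (hvbar : ((p : ℕ) : 𝓞 K) ∈ vbar.asIdeal) {𝔤 : Ideal (𝓞 K)}
    (h𝔤 : 𝔤 ≠ ⊥) (hsupp : ∀ w : HeightOneSpectrum (𝓞 K), w.asIdeal ∣ 𝔤 → w ∈ S ∨ w = v ∨ w = vbar)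
    (χ : RayGal K 𝔤 →* ℂˣ) {𝒰 : SubgroupTower (absoluteGaloisGroup K)}
    (hU : ∀ n, IsOpen (𝒰.U n : Set (absoluteGaloisGroup K)))
    (hN : ⋂ n, (𝒰.U n : Set (absoluteGaloisGroup K)) ⊆ rayKer K p S)
    (μ : GroupDistribution 𝒰 ℂ_[p]) :
    ∃ N : ℕ, (𝒰.U N : Set (absoluteGaloisGroup K)) ⊆ (absRestrictNormalHom (rayClassField K 𝔤)).ker ∧
      μ.integral (galCharInv ι 𝔤 χ) =
        ∑ a ∈ 𝒰.cells N, μ.μ N a * galCharInv ι 𝔤 χ (𝒰.repr N a) := by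
  obtain ⟨N, hNk⟩ := 𝒰.exists_subset_of_isOpen hU hN (isOpen_ker_absRestrictNormalHom _)
    (fun ν hν ↦ rayKer_le_ker S v vbar hv hvbar 𝔤 h𝔤 hsupp hν)
  refine ⟨N, hNk, μ.integral_eq_sum_of_factorsThrough
    (fun a ↦ galCharInv ι 𝔤 χ (𝒰.repr N a)) fun x ↦ ?_⟩
  have hmem : (𝒰.repr N (𝒰.proj N x))⁻¹ * x ∈ 𝒰.U N :=
    𝒰.proj_eq_iff.mp (𝒰.proj_repr N _)
  have h1 : absRestrictNormalHom (rayClassField K 𝔤) ((𝒰.repr N (𝒰.proj N x))⁻¹ * x) = 1 := hNk hmem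
  rw [map_mul, map_inv, inv_mul_eq_one] at h1
  simp only [galCharInv, h1]

omit [Fact p.Prime] [NumberField K] in
/-- `α_a ∉ v`: `α_a ≡ a (vⁿ)` with `a` a unit mod `pⁿ`, `n ≥ 1`, `p ∈ v`. [folklore] -/
private theorem not_mem_of_kappaRep {v : HeightOneSpectrum (𝓞 K)} (hv : ((p : ℕ) : 𝓞 K) ∈ v.asIdeal)
    {n : ℕ} (hn : 1 ≤ n) (a : (ZMod (p ^ n))ˣ) {x : 𝓞 K}
    (hx : x - ((a : ZMod (p ^ n)).val : 𝓞 K) ∈ v.asIdeal ^ n) : x ∉ v.asIdeal := by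
  intro hxv
  obtain ⟨s, t, hst⟩ :
      IsCoprime ((((a : ZMod (p ^ n)).val : ℕ) : 𝓞 K)) (((p ^ n : ℕ) : 𝓞 K)) :=
    (ZMod.val_coe_unit_coprime a).cast
  have ha : (((a : ZMod (p ^ n)).val : ℕ) : 𝓞 K) ∈ v.asIdeal := by
    have := v.asIdeal.sub_mem hxv (Ideal.pow_le_self (by omega : n ≠ 0) hx)
    rwa [sub_sub_cancel] at this
  have hp : ((p ^ n : ℕ) : 𝓞 K) ∈ v.asIdeal := by
    rw [Nat.cast_pow]; exact v.asIdeal.pow_mem_of_mem hv n (by omega)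
  have h1 : (1 : 𝓞 K) ∈ v.asIdeal :=
    hst ▸ v.asIdeal.add_mem (v.asIdeal.mul_mem_left s ha) (v.asIdeal.mul_mem_left t hp)
  exact v.isPrime.ne_top ((Ideal.eq_top_iff_one _).mpr h1)

omit [Fact p.Prime] in
/-- **(d2) The `κ`-representatives are prime to `𝔤 = 𝔣vⁿ`** (`α_a ≡ 1 (𝔣)`, `α_a ≡ a (vⁿ)`, `a` a unit mod
`pⁿ` ⟹ `((α_a), 𝔣vⁿ) = 1`): `artinSymbol (galFrob K (K(𝔤))) (α_a)` is the genuine Artin symbol `δ_a` of (30).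
[cite: deShalit1987, II.4.11 (30) (p. 65–66)] [cite: NeukirchANT1999, Ch. VI §7 (7.1)] -/
theorem isCoprime_span_kappaRep {v : HeightOneSpectrum (𝓞 K)} (hv : ((p : ℕ) : 𝓞 K) ∈ v.asIdeal)
    {n : ℕ} (hn : 1 ≤ n) {𝔣 : Ideal (𝓞 K)} (a : (ZMod (p ^ n))ˣ) {x : 𝓞 K} (hx1 : x - 1 ∈ 𝔣)
    (hx : x - ((a : ZMod (p ^ n)).val : 𝓞 K) ∈ v.asIdeal ^ n) :
    IsCoprime (Ideal.span {x}) (𝔣 * v.asIdeal ^ n) := by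
  refine IsCoprime.mul_right ?_ (IsCoprime.pow_right ?_)
  · exact Ideal.isCoprime_iff_exists.mpr
      ⟨x, Ideal.mem_span_singleton_self x, 1 - x, by simpa using 𝔣.neg_mem hx1, by ring⟩
  · rw [Ideal.isCoprime_iff_sup_eq]
    have hmax : v.asIdeal.IsMaximal := v.isPrime.isMaximal v.ne_bot
    refine hmax.1.2 _ (lt_of_le_of_ne le_sup_right fun h ↦ not_mem_of_kappaRep hv hn a hx ?_)
    rw [h]; exact le_sup_left (b := v.asIdeal) (Ideal.mem_span_singleton_self x)

/-! ## §3 H1: the lift `γ₀` — ONE absolute Frobenius serves every abelian level at once -/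

/-- `F(𝔭ⁿ) = f(𝔭)ⁿ` for the multiplicative extension `artinSymbol` of `f` to ideals. [folklore] -/
private theorem artinSymbol_asIdeal_pow {G : Type*} [CommGroup G]
    (f : HeightOneSpectrum (𝓞 K) → G) (v : HeightOneSpectrum (𝓞 K)) (n : ℕ) :
    artinSymbol f (v.asIdeal ^ n) = f v ^ n := by
  have h := artinSymbol_finsuppProd f (Finsupp.single v n)
  simp only [Finsupp.prod_single_index, pow_zero] at h
  exact h

/-- **Frobenius restricts to Frobenius**: an arithmetic Frobenius `σ ∈ Γ_K` at a prime `𝔓 ∣ v` of `ℤ̄_K`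
restricts, on every finite ABELIAN `L ⊆ K̄` unramified at `v`, to `galFrob K L v`.
[cite: NeukirchANT1999, Ch. I §9 (9.5)] [cite: SerreAbelianLadic1968, Ch. I §2.1] -/
theorem absRestrictNormalHom_eq_galFrob (L : IntermediateField K (AlgebraicClosure K))
    [FiniteDimensional K L] [IsAbelianGalois K L] [NumberField L] {v : HeightOneSpectrum (𝓞 K)}
    (hunr : Algebra.IsUnramifiedIn (𝓞 L) v.asIdeal) {𝔓 : Ideal (absIntegers (𝓞 K) K)}
    (h𝔓 : 𝔓 ∈ v.primesAbove) {σ : absoluteGaloisGroup K} (hσ : IsArithFrobAt (𝓞 K) σ 𝔓) :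
    absRestrictNormalHom L σ = galFrob K L v := by
  haveI : 𝔓.IsPrime := h𝔓.1
  exact eq_galFrob (commute_of_isAbelianGalois L) hunr
    (comap_ringOfIntegersToIntegralClosure_mem_primesOver_of_mem_primesAbove _ h𝔓)
    (isArithFrobAt_absRestrictNormalHom _ hσ)

/-- **One absolute Frobenius for all abelian levels at once**: some `σ ∈ Γ_K` (an arithmetic Frobenius at a
prime `𝔓 ∣ v` of `ℤ̄_K`, `exists_isArithFrobAt_of_mem_primesAbove_holds`) restricts to `galFrob K L v` on EVERY
finite abelian `L ⊆ K̄` unramified at `v`. [cite: SerreAbelianLadic1968, Ch. I §2.1] [cite: NeukirchANT1999, Ch. I §9 Prop. (9.4)] -/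
theorem exists_forall_absRestrictNormalHom_eq_galFrob (v : HeightOneSpectrum (𝓞 K)) :
    ∃ σ : absoluteGaloisGroup K, ∀ (L : IntermediateField K (AlgebraicClosure K))
      [FiniteDimensional K L] [NumberField L] [IsAbelianGalois K L],
      Algebra.IsUnramifiedIn (𝓞 L) v.asIdeal → absRestrictNormalHom L σ = galFrob K L v := by
  obtain ⟨𝔓, h𝔓⟩ := v.primesAbove_nonempty
  obtain ⟨σ, hσ⟩ := HeightOneSpectrum.exists_isArithFrobAt_of_mem_primesAbove_holds h𝔓
  exact ⟨σ, fun L _ _ _ hunr ↦ absRestrictNormalHom_eq_galFrob L hunr h𝔓 hσ⟩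

/-- **The universal Frobenius-power lift**: `γ₀ = Frob_𝔓ⁿ ∈ Γ_K` restricts to the Artin symbol `(vⁿ, K(𝔪)/K)`
for EVERY modulus `𝔪 ≠ 0` not divisible by `v` (de Shalit's `φ = (𝔭, F′/K)` on `F′ = K(𝔣𝔭̄^∞)`).
[cite: deShalit1987, II.4.11 (30) (p. 65–66)] [cite: SerreAbelianLadic1968, Ch. I §2.1] -/
theorem exists_frobPowLift (v : HeightOneSpectrum (𝓞 K)) (n : ℕ) :
    ∃ γ₀ : absoluteGaloisGroup K, ∀ (𝔪 : Ideal (𝓞 K)), 𝔪 ≠ ⊥ → ¬ 𝔪 ≤ v.asIdeal →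
      absRestrictNormalHom (rayClassField K 𝔪) γ₀ =
        artinSymbol (galFrob K (rayClassField K 𝔪)) (v.asIdeal ^ n) := by
  obtain ⟨σ, hσ⟩ := exists_forall_absRestrictNormalHom_eq_galFrob (K := K) v
  refine ⟨σ ^ n, fun 𝔪 h𝔪 hv ↦ ?_⟩
  rw [map_pow, artinSymbol_asIdeal_pow, hσ (rayClassField K 𝔪) (isUnramifiedIn_rayClassField h𝔪 hv)]

omit [Fact p.Prime] in
/-- `v ∤ 𝔣v̄^m` for `𝔣` prime to `v` and `v̄ ≠ v`. [folklore] -/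
private theorem not_mul_pow_le {𝔣 : Ideal (𝓞 K)} {v vbar : HeightOneSpectrum (𝓞 K)}
    (hv : IsCoprime 𝔣 v.asIdeal) (hne : vbar ≠ v) (m : ℕ) : ¬ 𝔣 * vbar.asIdeal ^ m ≤ v.asIdeal := by
  intro h
  rcases (Ideal.IsPrime.mul_le v.isPrime).mp h with h1 | h1
  · exact v.isPrime.ne_top (top_le_iff.mp ((Ideal.isCoprime_iff_sup_eq.mp hv).symm.le.trans (sup_le h1 le_rfl)))
  · exact hne (HeightOneSpectrum.ext ((vbar.isPrime.isMaximal vbar.ne_bot).eq_of_le v.isPrime.ne_top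
      (v.isPrime.le_of_pow_le h1)))

/-- **H1 — the `γ₀`-binder of `IsCosetValues` is witnessed**: compatible Artin symbols `(vⁿ, K(𝔣v̄^m)/K)`
for ALL `m` are the restrictions of `Frob_𝔓ⁿ` (`v` is unramified in every `K(𝔣v̄^m)` since `v ∤ 𝔣v̄^m`).
[cite: deShalit1987, II.4.11 (30) (p. 65–66)] [cite: SerreAbelianLadic1968, Ch. I §2.1] -/
theorem exists_frobLift (𝔣 : Ideal (𝓞 K)) (h𝔣 : 𝔣 ≠ ⊥) (v vbar : HeightOneSpectrum (𝓞 K))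
    (hv : IsCoprime 𝔣 v.asIdeal) (hne : vbar ≠ v) (n : ℕ) :
    ∃ γ₀ : absoluteGaloisGroup K, ∀ m : ℕ,
      absRestrictNormalHom (rayClassField K (𝔣 * vbar.asIdeal ^ m)) γ₀ =
        artinSymbol (galFrob K (rayClassField K (𝔣 * vbar.asIdeal ^ m))) (v.asIdeal ^ n) := by
  obtain ⟨γ₀, hγ₀⟩ := exists_frobPowLift v n
  exact ⟨γ₀, fun m ↦ hγ₀ _ (mul_ne_zero h𝔣 (pow_ne_zero m vbar.ne_bot)) (not_mul_pow_le hv hne m)⟩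

/-! ## §4 H3: the elliptic unit `e_n(𝔞) = Θ(1; 𝔤, 𝔞) ∈ K(𝔤)` and the period data; §5 orientation, CRT -/

omit [Fact p.Prime] in
/-- **H3 — the unit binder of `IsCosetValues` is witnessed** (modulo the named fact II.2.4 (i)): `ιK(𝔤)` is a
CM lattice, `1` a primitive `𝔤`-division point of it, `(𝔞, 6𝔤) = 1 ⇒ (𝔞, 𝔤) = 1`, so
`exists_mem_rayClassField_eq_deShalitTheta` gives `e_n(𝔞) = Θ(1; 𝔤, 𝔞) ∈ ι̂(K(𝔤))`.
[cite: deShalit1987, II.2.4 Proposition (i) (p. 46), II.5.2 (p. 80)] -/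
theorem exists_unit (h24 : ComplexMultiplication.EllipticUnits.DeShalit1987.prop24_i_mem_rayClassField)
    (hK : IsImaginaryQuadratic K) (ιK : K →+* ℂ) (𝔤 𝔞 : Ideal (𝓞 K)) (h𝔤 : 𝔤 ≠ ⊥) (h𝔤' : 𝔤 ≠ ⊤)
    (h𝔞 : 𝔞 ≠ ⊥) (hcop : IsCoprime 𝔞 (Ideal.span {(6 : 𝓞 K)} * 𝔤)) (L La : PeriodPair) (T : Finset ℂ)
    (hL : ∀ z : ℂ, z ∈ L.lattice ↔ ∃ a ∈ 𝔤, z = ιK (a : K))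
    (hLa : La.lattice = idealInvLattice ιK 𝔞 L.lattice) (hT : L.IsLatticeReps La T) :
    ∃ u : rayClassField K 𝔤, algClosureEmb ιK (u : AlgebraicClosure K) = L.deShalitTheta La T 1 :=
  exists_mem_rayClassField_eq_deShalitTheta h24 hK ιK (isCMLattice_of_mem_iff hL) h𝔤 h𝔤'
    (isPrimitiveDivisionPoint_one_of_mem_iff hL) h𝔞 hcop.of_mul_right_right hLa hT

omit [Fact p.Prime] in
/-- **The period/unit binders `(L, La, T, u)` of `IsCosetValues` are jointly instantiable** (period pairs with
lattices `ιK(𝔤)`, `𝔞⁻¹ιK(𝔤)`, representatives `T ∋ 0` of `𝔞⁻¹L/L`, and the unit of H3).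
[cite: deShalit1987, II.2.3 (10) (p. 42), II.2.4 (i) (p. 46), II.5.2 (4) (p. 80)] -/
theorem exists_thetaData (h24 : ComplexMultiplication.EllipticUnits.DeShalit1987.prop24_i_mem_rayClassField)
    (hK : IsImaginaryQuadratic K) (ιK : K →+* ℂ) {𝔤 𝔞 : Ideal (𝓞 K)} (h𝔤 : 𝔤 ≠ ⊥) (h𝔤' : 𝔤 ≠ ⊤)
    (h𝔞 : 𝔞 ≠ ⊥) (hcop : IsCoprime 𝔞 (Ideal.span {(6 : 𝓞 K)} * 𝔤)) :
    ∃ (L La : PeriodPair) (T : Finset ℂ) (u : rayClassField K 𝔤),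
      (∀ z : ℂ, z ∈ L.lattice ↔ ∃ a ∈ 𝔤, z = ιK (a : K)) ∧
      La.lattice = idealInvLattice ιK 𝔞 L.lattice ∧ L.IsLatticeReps La T ∧
      algClosureEmb ιK (u : AlgebraicClosure K) = L.deShalitTheta La T 1 := by
  obtain ⟨L, hL⟩ := exists_periodPair_mem_iff_ideal hK ιK h𝔤
  obtain ⟨La, hLa⟩ := exists_periodPair_lattice_eq_idealInvLattice (isCMLattice_of_mem_iff hL) h𝔞
  have hle : L.lattice ≤ La.lattice := by
    rw [hLa]; exact le_idealInvLattice (isCMLattice_of_mem_iff hL) 𝔞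
  obtain ⟨T, hT⟩ := PeriodPair.IsLatticeReps.exists hle
  obtain ⟨u, hu⟩ := exists_unit h24 hK ιK 𝔤 𝔞 h𝔤 h𝔤' h𝔞 hcop L La T hL hLa hT
  exact ⟨L, La, T, u, hL, hLa, hT, hu⟩

omit [NumberField K] in
/-- **An orientation exists in `K̄`**: `e^{2πi/pⁿ}` is a `pⁿ`-th root of `1 = ι̂(1)`, hence `ι̂ ζ` for some
`ζ ∈ K̄` (`exists_algClosureEmb_eq_of_pow_eq`). [cite: deShalit1987, II.4.4 (p. 58)] -/
theorem exists_orientation (ιK : K →+* ℂ) (n : ℕ) :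
    ∃ ζ : AlgebraicClosure K,
      algClosureEmb ιK ζ = Complex.exp (2 * Real.pi * Complex.I / (p : ℂ) ^ n) := by
  refine exists_algClosureEmb_eq_of_pow_eq ιK (pow_pos (Fact.out : p.Prime).pos n) (y := 1) ?_
  have hmul : ((p ^ n : ℕ) : ℂ) * (2 * Real.pi * Complex.I / (p : ℂ) ^ n) = 2 * Real.pi * Complex.I := by
    have hp : (p : ℂ) ^ n ≠ 0 := pow_ne_zero _ (Nat.cast_ne_zero.mpr (Fact.out : p.Prime).ne_zero)
    rw [Nat.cast_pow]; field_simp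
  rw [map_one, ← Complex.exp_nat_mul, hmul, Complex.exp_two_pi_mul_I]

omit [Fact p.Prime] [NumberField K] in
/-- **`κ`-representatives exist** (CRT): `𝔣 + Pⁿ = 1` gives, for every `m`, an `α` with `α ≡ 1 (𝔣)` and
`α ≡ m (Pⁿ)` — de Shalit's `α_a` parametrising `Gal(K(𝔤)/K(𝔣)) ≅ (𝒪/𝔭ⁿ)ˣ` in (30); so the `α`-binder of
`IsCosetValues` is never vacuous. [cite: deShalit1987, II.4.11 (30) (p. 65–66)] -/
theorem exists_kappaReps (𝔣 P : Ideal (𝓞 K)) (h : IsCoprime 𝔣 P) (n : ℕ) (m : ℕ) :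
    ∃ α : 𝓞 K, α - 1 ∈ 𝔣 ∧ α - (m : 𝓞 K) ∈ P ^ n := by
  obtain ⟨x, hx, y, hy, hxy⟩ := Ideal.isCoprime_iff_exists.mp h.pow_right
  refine ⟨1 + ((m : 𝓞 K) - 1) * x, ?_, ?_⟩
  · have : 1 + ((m : 𝓞 K) - 1) * x - 1 = ((m : 𝓞 K) - 1) * x := by ring
    rw [this]; exact 𝔣.mul_mem_left _ hx
  · have : 1 + ((m : 𝓞 K) - 1) * x - (m : 𝓞 K) = -(((m : 𝓞 K) - 1) * y) := by
      have hx' : x = 1 - y := by rw [← hxy]; ring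
      rw [hx']; ring
    rw [this]; exact (P ^ n).neg_mem ((P ^ n).mul_mem_left _ hy)

/-! ## §6 THE CONSUMER FORM: `IsCosetValues` on a Thm-4.14 witness yields a value identity per key -/

omit [Fact p.Prime] [NumberField K] in
/-- `𝔣vⁿ ≠ 𝒪_K` for `n ≥ 1`. [folklore] -/
private theorem mul_pow_ne_top {𝔣 : Ideal (𝓞 K)} {v : HeightOneSpectrum (𝓞 K)} {n : ℕ} (hn : 1 ≤ n) :
    𝔣 * v.asIdeal ^ n ≠ ⊤ := fun h ↦
  v.isPrime.ne_top (top_le_iff.mp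
    (h.symm.le.trans (Ideal.mul_le_left.trans (Ideal.pow_le_self (by omega)))))

/-- **The consumer form: every binder of `IsCosetValues` is witnessed on a Thm-4.14 tower** (`U_n` open,
`⋂ U_n ⊆ rayKer K p S`). For EVERY key — `ιK` inducing `v`, modulus `𝔣` (`≠ 0`, prime to `v`, support exactly
`S ∪ {v̄}`, `w_𝔣 = 1`), level `n ≥ 1`, `𝔞 ≠ 0` prime to `6𝔣vⁿ`, `χ` of exact `v`-level `n` — there EXIST period data
`L, La, T`, the unit `u = e_n(𝔞) ∈ K(𝔣vⁿ)`, an orientation `ζ`, a Frobenius lift `γ₀` and `κ`-representatives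
`α` satisfying the clause's side conditions, with II.5.2 (4) holding for them (H1, H2′, H3, §5; modulo II.2.4 (i)).
[cite: deShalit1987, II.5.2 Theorem, proof eq. (4) (p. 80), II.4.11 (30) (p. 65–66), II.2.4 (i) (p. 46)] -/
theorem exists_cosetValueIdentity (h24 : ComplexMultiplication.EllipticUnits.DeShalit1987.prop24_i_mem_rayClassField)
    (hK : IsImaginaryQuadratic K) {ι : PadicAlgCl p ≃+* ℂ} {v vbar : HeightOneSpectrum (𝓞 K)}
    (hv : ((p : ℕ) : 𝓞 K) ∈ v.asIdeal) (hvbar : ((p : ℕ) : 𝓞 K) ∈ vbar.asIdeal) (hne : vbar ≠ v)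
    {S : Finset (HeightOneSpectrum (𝓞 K))} {𝒰 : SubgroupTower (absoluteGaloisGroup K)}
    {μ : GroupDistribution 𝒰 ℂ_[p]} (hU : ∀ n, IsOpen (𝒰.U n : Set (absoluteGaloisGroup K)))
    (hN : ⋂ n, (𝒰.U n : Set (absoluteGaloisGroup K)) ⊆ rayKer K p S)
    (hcv : IsCosetValues ι v vbar S 𝒰 μ)
    (ιK : K →+* ℂ) (hιK : ∀ k : 𝓞 K, k ∈ v.asIdeal ↔ ‖ι.symm (ιK (k : K))‖ < 1)
    (𝔣 : Ideal (𝓞 K)) (n : ℕ) (hn : 1 ≤ n) (h𝔣 : 𝔣 ≠ ⊥) (h𝔣v : IsCoprime 𝔣 v.asIdeal)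
    (hsupp : ∀ w : HeightOneSpectrum (𝓞 K), w.asIdeal ∣ 𝔣 ↔ (w ∈ S ∨ w = vbar))
    (hw : rootsOfUnityCongruentOne 𝔣 = 1)
    (𝔞 : Ideal (𝓞 K)) (h𝔞 : 𝔞 ≠ ⊥) (hcop : IsCoprime 𝔞 (Ideal.span {(6 : 𝓞 K)} * (𝔣 * v.asIdeal ^ n)))
    (χ : RayGal K (𝔣 * v.asIdeal ^ n) →* ℂˣ)
    (hχ : ∃ δ ∈ relGalSet K (𝔣 * v.asIdeal ^ n) (𝔣 * v.asIdeal ^ (n - 1)), χ δ ≠ 1) :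
    ∃ (L La : PeriodPair) (T : Finset ℂ) (u : rayClassField K (𝔣 * v.asIdeal ^ n))
      (ζ : AlgebraicClosure K) (γ₀ : absoluteGaloisGroup K) (α : (ZMod (p ^ n))ˣ → 𝓞 K),
      (∀ z : ℂ, z ∈ L.lattice ↔ ∃ a ∈ 𝔣 * v.asIdeal ^ n, z = ιK (a : K)) ∧
      La.lattice = idealInvLattice ιK 𝔞 L.lattice ∧ L.IsLatticeReps La T ∧
      algClosureEmb ιK (u : AlgebraicClosure K) = L.deShalitTheta La T 1 ∧
      algClosureEmb ιK ζ = Complex.exp (2 * Real.pi * Complex.I / (p : ℂ) ^ n) ∧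
      (∀ m : ℕ, absRestrictNormalHom (rayClassField K (𝔣 * vbar.asIdeal ^ m)) γ₀ =
        artinSymbol (galFrob K (rayClassField K (𝔣 * vbar.asIdeal ^ m))) (v.asIdeal ^ n)) ∧
      (∀ a, α a - 1 ∈ 𝔣 ∧ α a - ((a : ZMod (p ^ n)).val : 𝓞 K) ∈ v.asIdeal ^ n) ∧
      CosetValueIdentity ι ιK (𝔣 * v.asIdeal ^ n) n 𝔞 χ u γ₀ ζ α μ := by
  have h𝔤 : 𝔣 * v.asIdeal ^ n ≠ ⊥ := mul_ne_zero h𝔣 (pow_ne_zero n v.ne_bot)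
  obtain ⟨L, La, T, u, hL, hLa, hT, hu⟩ :=
    exists_thetaData h24 hK ιK h𝔤 (mul_pow_ne_top hn) h𝔞 hcop
  obtain ⟨ζ, hζ⟩ := exists_orientation (p := p) ιK n
  obtain ⟨γ₀, hγ₀⟩ := exists_frobLift 𝔣 h𝔣 v vbar h𝔣v hne n
  have hα : ∀ a : (ZMod (p ^ n))ˣ, ∃ x : 𝓞 K,
      x - 1 ∈ 𝔣 ∧ x - ((a : ZMod (p ^ n)).val : 𝓞 K) ∈ v.asIdeal ^ n :=
    fun a ↦ exists_kappaReps 𝔣 v.asIdeal h𝔣v n _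
  choose α hα using hα
  have htc : 𝒰.IsTowerContinuous (galCharInv ι (𝔣 * v.asIdeal ^ n) χ) :=
    isTowerContinuous_galCharInv ι hv hvbar h𝔤 (supp_mul_pow hsupp n) χ hU hN
  exact ⟨L, La, T, u, ζ, γ₀, α, hL, hLa, hT, hu, hζ, hγ₀, hα,
    hcv ιK hιK 𝔣 n hn h𝔣 h𝔣v hsupp hw 𝔞 hcop L La T hL hLa hT u hu χ hχ htc ζ hζ γ₀ hγ₀ α hα⟩

/-! ## §7 Frame form `∫χ̂⁻¹ dμ = c(key)·G(χ⁻¹)·Σ` -/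

/-- **The smoothing factor `12(χ⁻¹(𝔞) − N𝔞)` never vanishes for `N𝔞 ≥ 2`** (`χ⁻¹(𝔞)` is a root of unity,
`ι⁻¹` is injective). [cite: deShalit1987, II.5.2 proof eq. (3) (p. 79)] -/
theorem smoothingFactor_ne_zero (ι : PadicAlgCl p ≃+* ℂ) {𝔤 : Ideal (𝓞 K)}
    (χ : RayGal K 𝔤 →* ℂˣ) (g : RayGal K 𝔤) {N : ℕ} (hN : 2 ≤ N) :
    12 * (cval ι (χ g)⁻¹ - (N : ℂ_[p])) ≠ 0 := by
  have hfin : IsOfFinOrder (χ g)⁻¹ :=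
    isOfFinOrder_inv_iff.mpr (χ.isOfFinOrder (isOfFinOrder_of_finite g))
  have hnorm : ‖(((χ g)⁻¹ : ℂˣ) : ℂ)‖ = 1 := by
    obtain ⟨k, hk, hk1⟩ := hfin.exists_pow_eq_one
    have h1 : ‖(((χ g)⁻¹ : ℂˣ) : ℂ)‖ ^ k = 1 := by
      rw [← norm_pow, ← Units.val_pow_eq_pow_val, hk1, Units.val_one, norm_one]
    exact (pow_eq_one_iff_of_nonneg (norm_nonneg _) hk.ne').mp h1
  have hneC : (((χ g)⁻¹ : ℂˣ) : ℂ) ≠ (N : ℂ) := by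
    intro h
    have : ‖(N : ℂ)‖ = 1 := h ▸ hnorm
    rw [Complex.norm_natCast] at this
    have : (N : ℝ) = 1 := this
    norm_cast at this
    omega
  refine mul_ne_zero (by norm_num) (sub_ne_zero.mpr ?_)
  intro h
  apply hneC
  unfold cval at h
  have h1 : ((ι.symm (((χ g)⁻¹ : ℂˣ) : ℂ) : PadicAlgCl p) : ℂ_[p]) = ((N : PadicAlgCl p) : ℂ_[p]) := by
    rw [PadicComplex.coe_natCast]; exact h
  rw [PadicComplex.coe_eq, PadicComplex.coe_eq] at h1
  have h' : (ι.symm (((χ g)⁻¹ : ℂˣ) : ℂ) : PadicAlgCl p) = (N : PadicAlgCl p) :=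
    (algebraMap (PadicAlgCl p) ℂ_[p]).injective h1
  have := congrArg ι h'
  simpa using this

/-- **Frame form**: for `𝔞 ≠ 0, 𝒪_K` the identity II.5.2 (4) divides out to
`∫ χ̂⁻¹ dμ = (12(χ⁻¹(𝔞) − N𝔞))⁻¹ · G(χ⁻¹) · Σ_g χ(g) Log j_p(g·u)`. [cite: deShalit1987, II.5.2 proof eq. (4) (p. 80)] -/
theorem integral_eq_of_cosetValueIdentity {ι : PadicAlgCl p ≃+* ℂ} {ιK : K →+* ℂ}
    {𝔤 : Ideal (𝓞 K)} {n : ℕ} {𝔞 : Ideal (𝓞 K)} (h𝔞 : 𝔞 ≠ ⊥) (h𝔞' : 𝔞 ≠ ⊤)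
    {χ : RayGal K 𝔤 →* ℂˣ} {u : rayClassField K 𝔤}
    {γ₀ : absoluteGaloisGroup K} {ζ : AlgebraicClosure K} {α : (ZMod (p ^ n))ˣ → 𝓞 K}
    {𝒰 : SubgroupTower (absoluteGaloisGroup K)} {μ : GroupDistribution 𝒰 ℂ_[p]}
    (h : CosetValueIdentity ι ιK 𝔤 n 𝔞 χ u γ₀ ζ α μ) :
    μ.integral (galCharInv ι 𝔤 χ) =
      (12 * (cval ι (χ (artinSymbol (galFrob K (rayClassField K 𝔤)) 𝔞))⁻¹ -
        (Ideal.absNorm 𝔞 : ℂ_[p])))⁻¹ * gaussSumInv ι ιK 𝔤 n χ γ₀ ζ α * unitLogSum ι ιK 𝔤 χ u := by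
  have h0 : Ideal.absNorm 𝔞 ≠ 0 := fun h ↦ h𝔞 (Ideal.absNorm_eq_zero_iff.mp h)
  have h1 : Ideal.absNorm 𝔞 ≠ 1 := fun h ↦ h𝔞' (Ideal.absNorm_eq_one_iff.mp h)
  have hc := smoothingFactor_ne_zero ι χ (artinSymbol (galFrob K (rayClassField K 𝔤)) 𝔞) (N := Ideal.absNorm 𝔞)
    (by omega)
  unfold CosetValueIdentity at h
  rw [mul_assoc, ← h, ← mul_assoc, inv_mul_cancel₀ hc, one_mul]

end DeShalit1987


end Literature.NumberTheory.EllipticCurves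

end
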